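import Summits.AtomisticToContinuum.HydrodynamicLimit.Theorems.CollisionIsometryCLTMacroClosureTwoScaleDefs
import Summits.AtomisticToContinuum.HydrodynamicLimit.Theorems.CollisionIsometryCLTMacroClosureTwoScaleCells
import Summits.AtomisticToContinuum.HydrodynamicLimit.Theorems.CollisionIsometryCLTMacroClosureTwoScaleJensenPoint
import Summits.AtomisticToContinuum.HydrodynamicLimit.Theorems.CollisionIsometryCLTMacroClosureTwoScaleVelocityFactor
import Literature.MathematicalPhysics.KineticTheory.HardSphereEulerProofs
import HarnessLib

/-!
# Two-scale block MGF (line `IdeatorTwoGen1Sketch`, crux `MacroClosure`, stmt-AtomisticToContinuum-14870):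
# integrating out the velocities at a fixed shift

Support file (`--supports stmt-AtomisticToContinuum-14870`) of the line lead (continuation c2) towards the registered
stub `Barycentric.stub_blockMGF_twoScale`: the VELOCITY part of the cell bound. Under the homogeneous local Gibbs law
the positions and the velocities are independent (`lintegral_localGibbsMeasure`: hard-core uniform positions ⊗ i.i.d.
Maxwellians), the occupation pattern and the configurational factors depend on the positions only, and the product
over the cells of the kinetic factors `exp(γ' cellKin)` integrates to at most `K^{M³}` by the landed velocity
factorisation (`stub_twoScale_velocityFactor`) as soon as every cell holds more than `n₀` particles. What is left is
the configurational integral of `…BlockMGFPositionBound`, times the inverse partition function. Also: joint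
measurability of the cell occupation number and of the cell kinetic functional in (configuration, corner).
-/

noncomputable section

open MeasureTheory Filter Set Topology InformationTheory
open scoped ENNReal ContDiff Convolution

namespace Summit.AtomisticToContinuum.HydrodynamicLimit.Theorems.MacroClosureLine

open Literature.MathematicalPhysics.KineticTheory Literature.Analysis.FluidPDE
open Literature.Analysis.FunctionSpaces

namespace Barycentric

namespace BlockMGFTwoScale

variable {N : ℕ}

/-! ## Joint measurability of the cell data -/

/-- The cube-membership event of particle `i`, jointly in (configuration, corner), is measurable. [folklore] -/
theorem measurableSet_inCube_prod (ℓ : ℝ) (i : Fin (N + 1)) :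
    MeasurableSet {p : Config (N + 1) (Fin 3) T3 × T3 | inCube ℓ ((p.1 i).1 - p.2)} :=
  show MeasurableSet ((fun p : Config (N + 1) (Fin 3) T3 × T3 => (p.1 i).1 - p.2) ⁻¹' {w | inCube ℓ w}) from
    (JensenPoint.measurableSet_inCube ℓ).preimage
      ((((measurable_pi_apply i).comp measurable_fst).fst).sub measurable_snd)

/-- A cell sum of a measurable summand is jointly measurable. [folklore] -/
theorem measurable_cellSum {E : Type*} [MeasurableSpace E] [AddCommMonoid E] [MeasurableAdd₂ E]
    [MeasurableSingletonClass E] (ℓ : ℝ) {f : Fin (N + 1) → Config (N + 1) (Fin 3) T3 × T3 → E}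
    (hf : ∀ i, Measurable (f i)) :
    Measurable fun p : Config (N + 1) (Fin 3) T3 × T3 => ∑ i ∈ cellSet ℓ p.1 p.2, f i p := by
  have h : (fun p : Config (N + 1) (Fin 3) T3 × T3 => ∑ i ∈ cellSet ℓ p.1 p.2, f i p) =
      fun p => ∑ i, {p' : Config (N + 1) (Fin 3) T3 × T3 | inCube ℓ ((p'.1 i).1 - p'.2)}.indicator (f i) p := by
    funext p
    rw [cellSet, Finset.sum_filter]
    refine Finset.sum_congr rfl fun i _ => ?_
    by_cases hpi : inCube ℓ ((p.1 i).1 - p.2)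
    · rw [if_pos hpi, Set.indicator_of_mem (show p ∈ {p' : Config (N + 1) (Fin 3) T3 × T3 |
        inCube ℓ ((p'.1 i).1 - p'.2)} from hpi)]
    · rw [if_neg hpi, Set.indicator_of_notMem (show p ∉ {p' : Config (N + 1) (Fin 3) T3 × T3 |
        inCube ℓ ((p'.1 i).1 - p'.2)} from hpi)]
  rw [h]
  exact Finset.measurable_sum _ fun i _ => (hf i).indicator (measurableSet_inCube_prod ℓ i)

/-- The occupation number of the cube with lower corner `y`, as a real number, is jointly measurable in `(z, y)`.
[folklore] -/
theorem measurable_cellCount_real (ℓ : ℝ) :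
    Measurable fun p : Config (N + 1) (Fin 3) T3 × T3 => (cellCount ℓ p.1 p.2 : ℝ) := by
  have h : (fun p : Config (N + 1) (Fin 3) T3 × T3 => (cellCount ℓ p.1 p.2 : ℝ)) =
      fun p => ∑ _i ∈ cellSet ℓ p.1 p.2, (1 : ℝ) := by
    funext p
    rw [Finset.sum_const, nsmul_eq_mul, mul_one, cellCount]
  rw [h]
  exact measurable_cellSum ℓ fun _ => measurable_const

/-- The cell kinetic functional is jointly measurable in `(z, y)`. [folklore] -/
theorem measurable_cellKin (uc : V3) (θc ℓ : ℝ) :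
    Measurable fun p : Config (N + 1) (Fin 3) T3 × T3 => cellKin uc θc ℓ p.1 p.2 := by
  have hv : ∀ i : Fin (N + 1), Measurable fun p : Config (N + 1) (Fin 3) T3 × T3 => (p.1 i).2 :=
    fun i => ((measurable_pi_apply i).comp measurable_fst).snd
  have hS2 : Measurable fun p : Config (N + 1) (Fin 3) T3 × T3 => ∑ i ∈ cellSet ℓ p.1 p.2, ‖(p.1 i).2‖ ^ 2 :=
    measurable_cellSum ℓ fun i => (hv i).norm.pow_const 2
  have hS1 : Measurable fun p : Config (N + 1) (Fin 3) T3 × T3 => ∑ i ∈ cellSet ℓ p.1 p.2, (p.1 i).2 :=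
    measurable_cellSum ℓ fun i => hv i
  have hn := measurable_cellCount_real (N := N) ℓ
  unfold cellKin
  refine ((((hS2.sub ((hS1.norm.pow_const 2).div hn)).add
    (((hS1.sub (hn.smul measurable_const)).norm.pow_const 2).div hn)).div measurable_const).sub ?_)
  exact ((measurable_const.mul hn).div measurable_const).mul
    (measurable_const.add (Real.measurable_log.comp
      ((hS2.sub ((hS1.norm.pow_const 2).div hn)).div ((measurable_const.mul hn).mul measurable_const))))

/-! ## Integrating out the velocities -/

/-- **Integrating out the velocities at a fixed shift.** For a fixed shift `x` of the tiling of mesh `1/M`,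
`M = mesh N`, `ℓ = side N`, `V = (N+1)ℓ³`, under the homogeneous local Gibbs law the integral of
`𝟙{∀κ, aV ≤ n_κ ≤ 1.05σ⁻³V} Π_κ exp(γ'V confRate(n_κ/V)) exp(γ' cellKin_κ)` is at most `K^{M³} Z⁻¹` times the
configurational integral of `𝟙{hard core} 𝟙{∀κ, aV ≤ n_κ ≤ 1.05σ⁻³V} Π_κ exp(γ'V confRate(n_κ/V))`, provided
`n₀ < aV` (`K, n₀` = the constants of the velocity factorisation at tilt `γ'`, taken as a hypothesis in its
registered form). [folklore] -/
theorem shiftBound_core : ∀ (N M : ℕ), 0 < M → ∀ (ℓ : ℝ), ℓ = ((M : ℕ) : ℝ)⁻¹ → ∀ (σ a γ' : ℝ)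
    (uc : V3) (θc : ℝ), 0 < θc → ∀ (K : ℝ) (n₀ : ℕ),
    (∀ (ι : Type) [Fintype ι] (N : ℕ) (uc : V3) (θc : ℝ), 0 < θc → ∀ (ℓ : ℝ) (y : ι → T3) (q : Fin (N + 1) → T3),
      (∀ k k', k ≠ k' → Disjoint (cellSet ℓ (zipConfig (q, fun _ => (0 : V3))) (y k))
        (cellSet ℓ (zipConfig (q, fun _ => (0 : V3))) (y k'))) →
      (∀ k, n₀ < cellCount ℓ (zipConfig (q, fun _ => (0 : V3))) (y k)) →
      ∫⁻ v, ∏ k, ENNReal.ofReal (Real.exp (γ' * cellKin uc θc ℓ (zipConfig (q, v)) (y k)))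
          ∂(Measure.pi fun _ : Fin (N + 1) => gaussMeasure uc θc) ≤ ENNReal.ofReal K ^ Fintype.card ι) →
    ∀ (x : T3), (n₀ : ℝ) < a * (((N : ℝ) + 1) * ℓ ^ 3) → ∀ (Φ : Flow σ N),
    ∫⁻ z, {z : Config (N + 1) (Fin 3) T3 | ∀ κ : Fin 3 → Fin M,
          a * (((N : ℝ) + 1) * ℓ ^ 3) ≤ (cellCount ℓ z (x + Torus.proj (Torus.cellCorner M κ)) : ℝ) ∧
          (cellCount ℓ z (x + Torus.proj (Torus.cellCorner M κ)) : ℝ) * σ ^ 3 ≤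
            (1 + 1 / 64) ^ 3 * (((N : ℝ) + 1) * ℓ ^ 3)}.indicator (fun z =>
        ∏ κ : Fin 3 → Fin M, (ENNReal.ofReal (Real.exp (γ' * (((N : ℝ) + 1) * ℓ ^ 3) *
            confRate σ uc θc ((cellCount ℓ z (x + Torus.proj (Torus.cellCorner M κ)) : ℝ) /
              (((N : ℝ) + 1) * ℓ ^ 3)))) *
          ENNReal.ofReal (Real.exp (γ' * cellKin uc θc ℓ z (x + Torus.proj (Torus.cellCorner M κ)))))) z
      ∂(localGibbsLaw σ (fun _ => (1 : ℝ)) (fun _ => uc) (fun _ => θc) N Φ) ≤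
    ENNReal.ofReal K ^ M ^ 3 *
      (ENNReal.ofReal ((volume (posDomain (hsDiameter σ N) (N + 1))).toReal⁻¹) *
        ∫⁻ q, (posDomain (hsDiameter σ N) (N + 1)).indicator (fun q =>
          {q : Fin (N + 1) → T3 | ∀ κ : Fin 3 → Fin M,
              a * (((N : ℝ) + 1) * ℓ ^ 3) ≤
                (cellCount ℓ (zipConfig (q, fun _ => (0 : V3))) (x + Torus.proj (Torus.cellCorner M κ)) : ℝ) ∧
              (cellCount ℓ (zipConfig (q, fun _ => (0 : V3))) (x + Torus.proj (Torus.cellCorner M κ)) : ℝ) * σ ^ 3 ≤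
                (1 + 1 / 64) ^ 3 * (((N : ℝ) + 1) * ℓ ^ 3)}.indicator (fun q =>
            ∏ κ : Fin 3 → Fin M, ENNReal.ofReal (Real.exp (γ' * (((N : ℝ) + 1) * ℓ ^ 3) *
              confRate σ uc θc ((cellCount ℓ (zipConfig (q, fun _ => (0 : V3)))
                (x + Torus.proj (Torus.cellCorner M κ)) : ℝ) / (((N : ℝ) + 1) * ℓ ^ 3))))) q) q) := by
  intro N M hM ℓ hℓM σ a γ' uc θc hθc K n₀ hVF x hn₀ Φ
  -- notation
  set V : ℝ := ((N : ℝ) + 1) * ℓ ^ 3 with hV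
  set d : ℝ := hsDiameter σ N with hd
  set c : (Fin 3 → Fin M) → T3 := fun κ => x + Torus.proj (Torus.cellCorner M κ) with hc
  set pD : Set (Fin (N + 1) → T3) := posDomain d (N + 1) with hpD
  set Aκ : (Fin 3 → Fin M) → ℕ → ℝ≥0∞ := fun _ n =>
    ENNReal.ofReal (Real.exp (γ' * V * confRate σ uc θc ((n : ℝ) / V))) with hAκ
  set OccZ : Set (Config (N + 1) (Fin 3) T3) := {z | ∀ κ, a * V ≤ (cellCount ℓ z (c κ) : ℝ) ∧
    (cellCount ℓ z (c κ) : ℝ) * σ ^ 3 ≤ (1 + 1 / 64) ^ 3 * V} with hOccZ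
  set OccQ : Set (Fin (N + 1) → T3) := {q | ∀ κ, a * V ≤ (cellCount ℓ (zipConfig (q, fun _ => (0 : V3))) (c κ) : ℝ) ∧
    (cellCount ℓ (zipConfig (q, fun _ => (0 : V3))) (c κ) : ℝ) * σ ^ 3 ≤ (1 + 1 / 64) ^ 3 * V} with hOccQ
  set Θ : Config (N + 1) (Fin 3) T3 → ℝ≥0∞ := fun z => OccZ.indicator (fun z =>
    ∏ κ, (Aκ κ (cellCount ℓ z (c κ)) *
      ENNReal.ofReal (Real.exp (γ' * cellKin uc θc ℓ z (c κ))))) z with hΘ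
  set I : (Fin (N + 1) → T3) → ℝ≥0∞ := fun q => OccQ.indicator (fun q =>
    ∏ κ, Aκ κ (cellCount ℓ (zipConfig (q, fun _ => (0 : V3))) (c κ))) q with hI
  -- measurability of `Θ`
  have hpair : ∀ κ, Measurable fun z : Config (N + 1) (Fin 3) T3 => (z, c κ) := fun κ =>
    measurable_id.prodMk measurable_const
  have hcount : ∀ κ, Measurable fun z : Config (N + 1) (Fin 3) T3 => (cellCount ℓ z (c κ) : ℝ) := fun κ => by
    have h := (measurable_cellCount_real (N := N) ℓ).comp (hpair κ)
    dsimp only [Function.comp_def] at h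
    exact h
  have hkin : ∀ κ, Measurable fun z : Config (N + 1) (Fin 3) T3 => cellKin uc θc ℓ z (c κ) := fun κ => by
    have h := (measurable_cellKin (N := N) uc θc ℓ).comp (hpair κ)
    dsimp only [Function.comp_def] at h
    exact h
  have hA_of_real : ∀ κ (z : Config (N + 1) (Fin 3) T3), Aκ κ (cellCount ℓ z (c κ)) =
      ENNReal.ofReal (Real.exp (γ' * V * confRate σ uc θc ((cellCount ℓ z (c κ) : ℝ) / V))) := fun κ z => rfl
  have hOccZm : MeasurableSet OccZ := by
    have : OccZ = ⋂ κ, {z | a * V ≤ (cellCount ℓ z (c κ) : ℝ)} ∩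
        {z | (cellCount ℓ z (c κ) : ℝ) * σ ^ 3 ≤ (1 + 1 / 64) ^ 3 * V} := by
      ext z; simp only [hOccZ, Set.mem_setOf_eq, Set.mem_iInter, Set.mem_inter_iff]
    rw [this]
    exact MeasurableSet.iInter fun κ => (measurableSet_le measurable_const (hcount κ)).inter
      (measurableSet_le ((hcount κ).mul measurable_const) measurable_const)
  -- `confRate ∘ (count / V)` is measurable because the count takes countably many values
  have hAm : ∀ κ, Measurable fun z : Config (N + 1) (Fin 3) T3 => Aκ κ (cellCount ℓ z (c κ)) := by
    intro κ
    have hnat : Measurable fun z : Config (N + 1) (Fin 3) T3 => cellCount ℓ z (c κ) := by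
      refine measurable_to_countable' fun m => ?_
      have : (fun z : Config (N + 1) (Fin 3) T3 => cellCount ℓ z (c κ)) ⁻¹' {m} =
          {z | (cellCount ℓ z (c κ) : ℝ) = m} := by
        ext z; simp only [Set.mem_preimage, Set.mem_singleton_iff, Set.mem_setOf_eq, Nat.cast_inj]
      rw [this]
      exact measurableSet_eq_fun (hcount κ) measurable_const
    exact (measurable_of_countable fun n : ℕ => Aκ κ n).comp hnat
  have hΘm : Measurable Θ := by
    refine Measurable.indicator ?_ hOccZm
    refine Finset.measurable_prod _ fun κ _ => (hAm κ).mul ?_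
    exact (measurable_const.mul (hkin κ)).exp.ennreal_ofReal
  -- disintegration into positions and velocities
  rw [localGibbsLaw_eq, lintegral_localGibbsMeasure continuous_const continuous_const continuous_const
    (fun _ => zero_le_one) (fun _ => hθc) σ N hΘm]
  -- the partition function and the position weight for the constant activity `1`
  have hpW : ∀ q : Fin (N + 1) → T3, posWeight (fun _ => (1 : ℝ)) (hsDiameter σ N) (N + 1) q = pD.indicator 1 q := by
    intro q
    simp only [posWeight, Finset.prod_const_one, hpD, hd]
    rfl
  have hZ : Literature.Analysis.FluidPDE.canonicalPartition (Literature.Analysis.FluidPDE.Torus.geometry (Fin 3))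
      (hsDiameter σ N) (N + 1) (localGibbsProfile (fun _ => (1 : ℝ)) (fun _ => uc) (fun _ => θc)) = (volume pD).toReal := by
    rw [canonicalPartition_eq_posPartition continuous_const continuous_const continuous_const (fun _ => zero_le_one)
      (fun _ => hθc), posPartition]
    simp_rw [hpW]
    rw [integral_indicator_one (measurableSet_posDomain d (N + 1))]
    rfl
  -- the inner velocity integral, pointwise in the positions
  have hinner : ∀ q : Fin (N + 1) → T3,
      ∫⁻ v, Θ (zipConfig (q, v)) ∂(velMeasure (fun _ => uc) (fun _ => θc) q) ≤ I q * ENNReal.ofReal K ^ M ^ 3 := by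
    intro q
    -- the occupation data do not see the velocities
    have hcq : ∀ (v : Fin (N + 1) → V3) κ, cellCount ℓ (zipConfig (q, v)) (c κ) =
        cellCount ℓ (zipConfig (q, fun _ => (0 : V3))) (c κ) := fun v κ => rfl
    by_cases hq : q ∈ OccQ
    · have hΘq : ∀ v, Θ (zipConfig (q, v)) = I q *
          ∏ κ, ENNReal.ofReal (Real.exp (γ' * cellKin uc θc ℓ (zipConfig (q, v)) (c κ))) := by
        intro v
        have hzq : zipConfig (q, v) ∈ OccZ := fun κ => by rw [hcq v κ]; exact hq κ
        simp only [hΘ, hI, Set.indicator_of_mem hzq, Set.indicator_of_mem hq, Finset.prod_mul_distrib]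
        simp only [hcq v]
      simp_rw [hΘq]
      rw [lintegral_const_mul' _ _ (by
        simp only [hI, Set.indicator_of_mem hq]
        exact ENNReal.prod_ne_top fun κ _ => ENNReal.ofReal_ne_top)]
      gcongr
      -- the velocity factorisation
      have hdisj := ((stub_twoScale_cells M hM x).2.2.2 N (zipConfig (q, fun _ => (0 : V3)))).1
      rw [← hℓM] at hdisj
      have hfloor : ∀ κ, n₀ < cellCount ℓ (zipConfig (q, fun _ => (0 : V3))) (c κ) := by
        intro κ
        have h := (hq κ).1
        exact_mod_cast hn₀.trans_le h
      have h := hVF (Fin 3 → Fin M) N uc θc hθc ℓ c q hdisj hfloor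
      rw [Fintype.card_fun, Fintype.card_fin, Fintype.card_fin] at h
      exact h
    · have hΘq : ∀ v, Θ (zipConfig (q, v)) = 0 := by
        intro v
        have hzq : zipConfig (q, v) ∉ OccZ := fun h => hq fun κ => by rw [← hcq v κ]; exact h κ
        simp only [hΘ, Set.indicator_of_notMem hzq]
      simp_rw [hΘq]
      rw [lintegral_zero]
      exact zero_le
  -- assemble
  have hZ0 : 0 ≤ ((volume pD).toReal)⁻¹ := inv_nonneg.2 ENNReal.toReal_nonneg
  calc ∫⁻ q, ENNReal.ofReal ((Literature.Analysis.FluidPDE.canonicalPartition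
          (Literature.Analysis.FluidPDE.Torus.geometry (Fin 3)) (hsDiameter σ N) (N + 1)
          (localGibbsProfile (fun _ => (1 : ℝ)) (fun _ => uc) (fun _ => θc)))⁻¹ *
          posWeight (fun _ => (1 : ℝ)) (hsDiameter σ N) (N + 1) q) *
        ∫⁻ v, Θ (zipConfig (q, v)) ∂(velMeasure (fun _ => uc) (fun _ => θc) q)
      ≤ ∫⁻ q, ENNReal.ofReal (((volume pD).toReal)⁻¹ * pD.indicator 1 q) * (I q * ENNReal.ofReal K ^ M ^ 3) := by
        refine lintegral_mono fun q => ?_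
        rw [hZ, hpW]
        gcongr
        exact hinner q
    _ = ∫⁻ q, ENNReal.ofReal K ^ M ^ 3 * (ENNReal.ofReal ((volume pD).toReal⁻¹) * pD.indicator I q) := by
        refine lintegral_congr fun q => ?_
        by_cases hq : q ∈ pD
        · rw [Set.indicator_of_mem hq, Set.indicator_of_mem hq, Pi.one_apply, mul_one]; ring
        · rw [Set.indicator_of_notMem hq, Set.indicator_of_notMem hq, mul_zero, ENNReal.ofReal_zero, zero_mul,
            mul_zero, mul_zero]
    _ = ENNReal.ofReal K ^ M ^ 3 * (ENNReal.ofReal ((volume pD).toReal⁻¹) * ∫⁻ q, pD.indicator I q) := by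
        rw [lintegral_const_mul' _ _ (ENNReal.pow_ne_top ENNReal.ofReal_ne_top),
          lintegral_const_mul' _ _ ENNReal.ofReal_ne_top]

end BlockMGFTwoScale

end Barycentric

end Summit.AtomisticToContinuum.HydrodynamicLimit.Theorems.MacroClosureLine

end
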